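import Summits.MatrixMultiplication.OmegaCensus.STPP222PowFromCardPoly
import Summits.MatrixMultiplication.OmegaCensus.STPP222PowFromCardPolyBase3
import Summits.MatrixMultiplication.OmegaCensus.STPPPatternMonotonicity
import Summits.MatrixMultiplication.OmegaCensus.STPPMixedProducts

/-!
# ω-census, small patterns `(2,1,1)^k` / `(1,2,2)^k`: SUPPLY laws in arbitrary finite abelian groups

Cell `pub-omega`, ω construction census, seat pub-omega ENG2 (gen 33). HONEST FRAMING (verbatim): lottery ticket; floor =
certified bounds/negative ranges.  Census STRUCTURE bookkeeping for column B5 (`T1(H)`, `T2(H)` over ALL finite abelian `H`, not only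
cyclic ones); nothing here bears on `ω`.

The cyclic columns have their all-`k` laws (`STPPSmallPatternCyclicThreeAPFree.lean`).  For arbitrary finite abelian groups this file
records the thin-pattern readings of two tools that the tree states for `(2,2,2)^k` only:

* PRODUCT SUPPLY (`isSTPP_prodTSF`, `STPPTricoloredProduct.lean`): `exists_isSTPP_211pow_mul_of_tsf` / `exists_isSTPP_122pow_mul_of_tsf` —
  **`(2,1,1)^N ⊆ H₁` (resp. `(1,2,2)^N`) and a tricolored sum-free set of size `k` in `H₂` give `(2,1,1)^{N·k} ⊆ H₁ × H₂`** (resp.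
  `(1,2,2)^{N·k}`): `T1(H₁ × H₂) ≥ T1(H₁) · TSF(H₂)`, `T2(H₁ × H₂) ≥ T2(H₁) · TSF(H₂)`.  With the graph tricolored sum-free set of
  `STPP222PowFromCardPoly.lean` (`exists_isTSF_prod_of_le_card`: size `k` in `K₂ × K₃` once `|K₂|, |K₃| ≥ k`) and the one-triple seeds
  `({0,f},{0},{0})` / `({0},{0,b},{0,c})` (`STPPMixedProducts.lean`): **`(2,1,1)^k ⊆ F × (K₂ × K₃)` for every `F` with a non-zero
  element and `|K₂|, |K₃| ≥ k`** (`exists_isSTPP_211pow_prod_of_le_card`; e.g. `ℤ/2 × ℤ/k × ℤ/k`, order `2k²`), and **`(1,2,2)^k ⊆ F × (K₂ × K₃)`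
  for every `F` carrying one `(1,2,2)` triple** (`exists_isSTPP_122pow_prod_of_le_card`; e.g. `ℤ/4 × ℤ/k × ℤ/k`).
* UNIFORM SUPPLY (`exists_isSTPP_222pow_of_card_ge_pow_six`, `…_of_card_ge_poly3`; stpp-3): by pattern monotonicity
  (`exists_isSTPP_of_embedding`) **every finite abelian group of order `≥ 2560·k⁶` (or `≥ 640·k²·9^t` with `k ≤ 2^t`) hosts `(2,1,1)^k` and
  `(1,2,2)^k`** — the uniform thresholds `U1(k) = min {n : every abelian group of order ≥ n hosts (2,1,1)^k}` and `U2(k)` are FINITE and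
  polynomially bounded (crude; the record: `U1(6) ≤ 30` by gen 32's order-30…47 theorem… only in the sense of that range — no all-order claim was
  made there; this file's bound is the first all-order one for every `k`).

No sharpness claimed anywhere.  References: H. Cohn, R. Kleinberg, B. Szegedy, C. Umans, FOCS 2005 (arXiv:math/0511460), Def. 5.1 and the
product remark of §7; J. Blasiak et al., Discrete Analysis 2017:3, Def. 3.1.  Seat pub-omega ENG2 (gen 33), 2026-08-28.
-/

open Literature.Computability.AlgebraicComplexity Literature.Combinatorics.Additive Finset

namespace Summit.MatrixMultiplication.OmegaCensus

section Product

variable {H₁ H₂ : Type*} [AddCommGroup H₁] [AddCommGroup H₂] {N k : ℕ}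

/-- **`T1(H₁ × H₂) ≥ T1(H₁) · TSF(H₂)`**: `(2,1,1)^N ⊆ H₁` and a tricolored sum-free set of size `k` in `H₂` give `(2,1,1)^{N·k} ⊆ H₁ × H₂`
(the tree's `isSTPP_prodTSF`; second factors are singletons, so the size pattern is unchanged). [cite: CohnKleinbergSzegedyUmans2005, Def. 5.1] -/
theorem exists_isSTPP_211pow_mul_of_tsf
    (h1 : ∃ A B C : Fin N → Finset H₁, IsSTPP A B C ∧ ∀ i, (A i).card = 2 ∧ (B i).card = 1 ∧ (C i).card = 1)
    {σ τ υ : Fin k → H₂} (hT : IsTricoloredSumFree σ τ υ) :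
    ∃ A B C : Fin (N * k) → Finset (H₁ × H₂), IsSTPP A B C ∧
      ∀ m, (A m).card = 2 ∧ (B m).card = 1 ∧ (C m).card = 1 := by
  obtain ⟨A, B, C, hS, hc⟩ := h1
  refine ⟨_, _, _, isSTPP_prodTSF hS hT, fun m => ?_⟩
  simp only [card_product, card_singleton, mul_one]
  exact hc _

/-- **`T2(H₁ × H₂) ≥ T2(H₁) · TSF(H₂)`**: `(1,2,2)^N ⊆ H₁` and a tricolored sum-free set of size `k` in `H₂` give `(1,2,2)^{N·k} ⊆ H₁ × H₂`.
[cite: CohnKleinbergSzegedyUmans2005, Def. 5.1] -/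
theorem exists_isSTPP_122pow_mul_of_tsf
    (h1 : ∃ A B C : Fin N → Finset H₁, IsSTPP A B C ∧ ∀ i, (A i).card = 1 ∧ (B i).card = 2 ∧ (C i).card = 2)
    {σ τ υ : Fin k → H₂} (hT : IsTricoloredSumFree σ τ υ) :
    ∃ A B C : Fin (N * k) → Finset (H₁ × H₂), IsSTPP A B C ∧
      ∀ m, (A m).card = 1 ∧ (B m).card = 2 ∧ (C m).card = 2 := by
  obtain ⟨A, B, C, hS, hc⟩ := h1
  refine ⟨_, _, _, isSTPP_prodTSF hS hT, fun m => ?_⟩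
  simp only [card_product, card_singleton, mul_one]
  exact hc _

end Product

section ThreeFactors

variable {F K₂ K₃ : Type*} [AddCommGroup F] [AddCommGroup K₂] [AddCommGroup K₃] [DecidableEq F] [Finite K₂] [Finite K₃]

/-- **`(2,1,1)^k ⊆ F × (K₂ × K₃)` whenever `F` has a non-zero element and `|K₂|, |K₃| ≥ k`** (one `(2,1,1)` triple `({0,f},{0},{0})` in `F`
times the graph tricolored sum-free set of size `k` in `K₂ × K₃`).  E.g. `T1(ℤ/2 × ℤ/k × ℤ/k) ≥ k`.
[cite: CohnKleinbergSzegedyUmans2005, Def. 5.1] -/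
theorem exists_isSTPP_211pow_prod_of_le_card {f : F} (hf : f ≠ 0) {k : ℕ} (h₂ : k ≤ Nat.card K₂) (h₃ : k ≤ Nat.card K₃) :
    ∃ A B C : Fin k → Finset (F × (K₂ × K₃)), IsSTPP A B C ∧ ∀ i, (A i).card = 2 ∧ (B i).card = 1 ∧ (C i).card = 1 := by
  obtain ⟨σ, τ, υ, hT⟩ := exists_isTSF_prod_of_le_card (K₂ := K₂) (K₃ := K₃) h₂ h₃
  have h1 : ∃ A B C : Fin 1 → Finset F, IsSTPP A B C ∧ ∀ i, (A i).card = 2 ∧ (B i).card = 1 ∧ (C i).card = 1 :=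
    ⟨_, _, _, isSTPP_pairPointPoint f, fun _ => ⟨by rw [card_pair hf.symm], card_singleton _, card_singleton _⟩⟩
  obtain ⟨A, B, C, hS, hc⟩ := exists_isSTPP_211pow_mul_of_tsf h1 hT
  refine ⟨fun i => A (Fin.cast (one_mul k).symm i), fun i => B (Fin.cast (one_mul k).symm i),
    fun i => C (Fin.cast (one_mul k).symm i), isSTPP_subfamily hS _ (Fin.cast_injective _), fun i => hc _⟩

/-- **`(1,2,2)^k ⊆ F × (K₂ × K₃)` whenever `F` carries one `(1,2,2)` triple `({0},{0,b},{0,c})` (`b, c ≠ 0`, `b ≠ ±c`; e.g. `F = ℤ/4`,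
`b = 1`, `c = 2`) and `|K₂|, |K₃| ≥ k`.**  E.g. `T2(ℤ/4 × ℤ/k × ℤ/k) ≥ k`. [cite: CohnKleinbergSzegedyUmans2005, Def. 5.1] -/
theorem exists_isSTPP_122pow_prod_of_le_card {b c : F} (hb : b ≠ 0) (hc0 : c ≠ 0) (hbc : b ≠ c) (hbc' : b ≠ -c) {k : ℕ}
    (h₂ : k ≤ Nat.card K₂) (h₃ : k ≤ Nat.card K₃) :
    ∃ A B C : Fin k → Finset (F × (K₂ × K₃)), IsSTPP A B C ∧ ∀ i, (A i).card = 1 ∧ (B i).card = 2 ∧ (C i).card = 2 := by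
  obtain ⟨σ, τ, υ, hT⟩ := exists_isTSF_prod_of_le_card (K₂ := K₂) (K₃ := K₃) h₂ h₃
  have hb0 : (0 : F) ≠ b := hb.symm
  have hc0' : (0 : F) ≠ c := hc0.symm
  have h1 : ∃ A B C : Fin 1 → Finset F, IsSTPP A B C ∧ ∀ i, (A i).card = 1 ∧ (B i).card = 2 ∧ (C i).card = 2 :=
    ⟨_, _, _, isSTPP_pointPairPair hb hc0 hbc hbc', fun _ => ⟨card_singleton _, by rw [card_pair hb0], by rw [card_pair hc0']⟩⟩
  obtain ⟨A, B, C, hS, hc⟩ := exists_isSTPP_122pow_mul_of_tsf h1 hT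
  refine ⟨fun i => A (Fin.cast (one_mul k).symm i), fun i => B (Fin.cast (one_mul k).symm i),
    fun i => C (Fin.cast (one_mul k).symm i), isSTPP_subfamily hS _ (Fin.cast_injective _), fun i => hc _⟩

/-- Worked instance: **`(2,1,1)^k ⊆ ℤ/2 × (ℤ/k × ℤ/k)`** for every `k ≥ 1` (order `2k²`; non-cyclic supply, no threshold claim).
[cite: CohnKleinbergSzegedyUmans2005, Def. 5.1] -/
theorem exists_isSTPP_211pow_zmod2_zmodk_zmodk (k : ℕ) [NeZero k] :
    ∃ A B C : Fin k → Finset (ZMod 2 × (ZMod k × ZMod k)), IsSTPP A B C ∧ ∀ i, (A i).card = 2 ∧ (B i).card = 1 ∧ (C i).card = 1 :=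
  exists_isSTPP_211pow_prod_of_le_card (f := (1 : ZMod 2)) (by decide) (by rw [Nat.card_zmod]) (by rw [Nat.card_zmod])

/-- Worked instance: **`(1,2,2)^k ⊆ ℤ/4 × (ℤ/k × ℤ/k)`** for every `k ≥ 1` (order `4k²`). [cite: CohnKleinbergSzegedyUmans2005, Def. 5.1] -/
theorem exists_isSTPP_122pow_zmod4_zmodk_zmodk (k : ℕ) [NeZero k] :
    ∃ A B C : Fin k → Finset (ZMod 4 × (ZMod k × ZMod k)), IsSTPP A B C ∧ ∀ i, (A i).card = 1 ∧ (B i).card = 2 ∧ (C i).card = 2 :=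
  exists_isSTPP_122pow_prod_of_le_card (b := (1 : ZMod 4)) (c := (2 : ZMod 4)) (by decide) (by decide) (by decide) (by decide)
    (by rw [Nat.card_zmod]) (by rw [Nat.card_zmod])

end ThreeFactors

section Uniform

/-- **Uniform supply, all `k`: every finite abelian group of order `≥ 2560·k⁶` hosts `(2,1,1)^k`** (the tree's `(2,2,2)^k` law
`exists_isSTPP_222pow_of_card_ge_pow_six` shrunk by pattern monotonicity). [cite: CohnKleinbergSzegedyUmans2005, Def. 5.1] -/
theorem exists_isSTPP_211pow_of_card_ge_pow_six (k : ℕ) {G : Type*} [AddCommGroup G] [Finite G]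
    (hG : 2560 * k ^ 6 ≤ Nat.card G) :
    ∃ A B C : Fin k → Finset G, IsSTPP A B C ∧ ∀ i, (A i).card = 2 ∧ (B i).card = 1 ∧ (C i).card = 1 :=
  exists_isSTPP_of_embedding (fun _ => 2) (fun _ => 2) (fun _ => 2) (fun _ => 2) (fun _ => 1) (fun _ => 1) id
    Function.injective_id (fun _ => le_rfl) (fun _ => by norm_num) (fun _ => by norm_num)
    (exists_isSTPP_222pow_of_card_ge_pow_six k hG)

/-- **Uniform supply, all `k`: every finite abelian group of order `≥ 2560·k⁶` hosts `(1,2,2)^k`.** [cite: CohnKleinbergSzegedyUmans2005, Def. 5.1] -/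
theorem exists_isSTPP_122pow_of_card_ge_pow_six (k : ℕ) {G : Type*} [AddCommGroup G] [Finite G]
    (hG : 2560 * k ^ 6 ≤ Nat.card G) :
    ∃ A B C : Fin k → Finset G, IsSTPP A B C ∧ ∀ i, (A i).card = 1 ∧ (B i).card = 2 ∧ (C i).card = 2 :=
  exists_isSTPP_of_embedding (fun _ => 2) (fun _ => 2) (fun _ => 2) (fun _ => 1) (fun _ => 2) (fun _ => 2) id
    Function.injective_id (fun _ => by norm_num) (fun _ => le_rfl) (fun _ => le_rfl)
    (exists_isSTPP_222pow_of_card_ge_pow_six k hG)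

/-- **Uniform supply, base-3 form: every finite abelian group of order `≥ 640·k²·9^t` hosts `(2,1,1)^k` and `(1,2,2)^k` for `k ≤ 2^t`**
(from `exists_isSTPP_222pow_of_card_ge_poly3`). [cite: CohnKleinbergSzegedyUmans2005, Def. 5.1] -/
theorem exists_isSTPP_211pow_122pow_of_card_ge_poly3 (t k : ℕ) (hk : k ≤ 2 ^ t) {G : Type*} [AddCommGroup G] [Finite G]
    (hG : 640 * k ^ 2 * 9 ^ t ≤ Nat.card G) :
    (∃ A B C : Fin k → Finset G, IsSTPP A B C ∧ ∀ i, (A i).card = 2 ∧ (B i).card = 1 ∧ (C i).card = 1) ∧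
    (∃ A B C : Fin k → Finset G, IsSTPP A B C ∧ ∀ i, (A i).card = 1 ∧ (B i).card = 2 ∧ (C i).card = 2) :=
  ⟨exists_isSTPP_of_embedding (fun _ => 2) (fun _ => 2) (fun _ => 2) (fun _ => 2) (fun _ => 1) (fun _ => 1) id
      Function.injective_id (fun _ => le_rfl) (fun _ => by norm_num) (fun _ => by norm_num)
      (exists_isSTPP_222pow_of_card_ge_poly3 t k hk hG),
    exists_isSTPP_of_embedding (fun _ => 2) (fun _ => 2) (fun _ => 2) (fun _ => 1) (fun _ => 2) (fun _ => 2) id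
      Function.injective_id (fun _ => by norm_num) (fun _ => le_rfl) (fun _ => le_rfl)
      (exists_isSTPP_222pow_of_card_ge_poly3 t k hk hG)⟩

end Uniform

end Summit.MatrixMultiplication.OmegaCensus
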